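import Summits.AtomisticToContinuum.HydrodynamicLimit.Theorems.AntiMazurCoboundariesKineticWindowGronwallWindowRenyiOfIncrementTightnessPrelim
import Summits.AtomisticToContinuum.HydrodynamicLimit.Theorems.AntiMazurCoboundariesKineticWindowGronwallPlusNode
import Literature.MathematicalPhysics.KineticTheory.CollisionWindowBookkeeping
import Literature.MathematicalPhysics.KineticTheory.HardSphereEulerProofs
import Literature.Analysis.FluidPDE.CollisionalTransferMeasurable
import Literature.Analysis.FluidPDE.HardSpherePhaseSpaceProofs
import Mathlib.MeasureTheory.Integral.MeanInequalities
import HarnessLib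

/-!
# The momentum increment over a kinetic window from the frozen-coefficient transfer
# (stub `stub_momentumIncrementOfFrozenTransfer`, line `board-node-dock`, crux `KineticWindowGronwall`, stmt-AtomisticToContinuum-9282)

Crux `Summit.AtomisticToContinuum.HydrodynamicLimit.Theses.AntiMazurCoboundaries.KineticWindowGronwall` (same term as
`…Theses.FluxGibbsianityLdDrude.KineticWindowGronwall`), line `board-node-dock` (lead c6). The wall of the crux is the LOCAL
kinetic node; its content (iii) is the order-`p` Rényi quasi-invariance of the local Gibbs laws `λ_N` over kinetic windows,
reduced (toolkit `WindowRenyiOfIncrementTightness`) to the exponential tightness H_E / H_M of the kinetic-window INCREMENTS of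
the weighted energy and of the tested momentum `M_J(z) = Σᵢ ⟪J(xᵢ), vᵢ⟫`, `J = u₀/θ₀` (`momentumObservable`).

THIS FILE isolates the dynamical core of H_M (registered toolkit statement `MomentumIncrementOfFrozenTransfer`): for EVERY
`c > 0`, IF the FROZEN-COEFFICIENT transfer `T(z) = Σᵢ ⟪J(xᵢ(s)), vᵢ(s) − vᵢ(0)⟫` has exponential moments `≤ e^{ε(N+1)}` at
parameter `2c` (eventually in `N`, uniformly over `0 ≤ s ≤ τ(N+1)^{-1/3}`), THEN so does the full increment
`M_J(Φ_s z) − M_J(z)` at parameter `c`. Proof: `M_J(Φ_s z) − M_J(z) = T + D` with the DISPLACEMENT part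
`D = Σᵢ ⟪J(xᵢ(s)) − J(xᵢ(0)), vᵢ(0)⟫`, linear in the time-`0` velocities (`momentumObservable_sub_eq`). STATICS: `J` is
bounded (`‖J‖ ≤ Jmax`) and has an affine modulus `‖J x − J y‖ ≤ δ + K·dist(x, y)` on the compact torus
(`exists_affine_modulus_vec`); one particle with displacement `d` contributes
`‖J x' − J x‖ ‖v‖ ≤ (δ + Kη)(1 + ‖v‖²)/2 + Jmax R d/η + (Jmax/R)‖v‖²` (`term_le`: small displacement `d < η`, or `d ≥ η` and
`‖v‖ ≤ R/2 + ‖v‖²/(2R)`), so that, with the forward path-length bound `Σᵢ dᵢ ≤ s((N+1)/2 + E(z))` on good orbits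
(`sum_euclidDist_flow_le`, from `HardSphereFlow.euclidDist_flow_le_integral_norm_vel` and `sum_integral_norm_vel_le`),
`|D| ≤ A · ((N+1)/2 + E(z))`, `A = δ + Kη + Jmax R s/η + 2Jmax/R` (`abs_sub_le_of_good`) — small once `R` is large, `δ, η`
small and then `s` small (the window length tends to `0`). Finally `exp(c|T + D|) ≤ exp(c|T|)·exp(cA((N+1)/2 + E))`,
Hölder(2,2) (`ENNReal.lintegral_mul_le_Lp_mul_Lq`), the hypothesis, and the Gaussian-fibre exponential moment of the kinetic
energy under `λ_N` (`KineticWindowGronwallWindowRenyiOfIncrementTightnessPrelim.lintegral_exp_mul_configEnergy_le`, valid for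
`x`-dependent temperature and drift and any reduced density) give the rate `((1 + C₀)cA + ε)/2 ≤ ε`
(`lintegral_exp_abs_sub_le`). No smallness condition on `c` is needed.
Folklore (local equilibrium states, Spohn 1991 Part I §2.3; hard-sphere trajectories are piecewise free flight, GST 2013 §4.1).
No Theses declaration is concluded; no named fact is used. -/

noncomputable section

namespace Summit.AtomisticToContinuum.HydrodynamicLimit.Theorems.KineticWindowGronwallMomentumIncrementOfFrozenTransfer

open _root_.MeasureTheory _root_.Set _root_.Filter
open scoped _root_.ENNReal
open Literature.Analysis.FluidPDE Literature.MathematicalPhysics.KineticTheory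

/-! ## §1 Statements (verbatim from the line's toolkit `Cruxes/KineticWindowGronwall/Lines/board_node_dock_toolkit.lean`) -/

/-- The hard-sphere flow of `N+1` spheres at reduced density `σ` on `𝕋³`. -/
abbrev TFlow (σ : ℝ) (N : ℕ) : Type :=
  HardSphereFlow (Torus.geometry (Fin 3)) (hsDiameter σ N) (N + 1)

/-- **Helper statement `MomentumIncrementOfFrozenTransfer`** (STATICS inside H_M; momentum twin of `EnergyIncrementOfFrozenTransfer`):
for continuous data with `a, θ₀ > 0` and a flow family, for EVERY `c > 0`: IF the frozen-coefficient collisional momentum transfer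
`Σᵢ ⟨u₀(xᵢ(s))/θ₀(xᵢ(s)), vᵢ(s) − vᵢ(0)⟩` has exponential moments `≤ e^{ε(N+1)}` at parameter `2c`, eventually, uniformly over
`0 ≤ s ≤ τ(N+1)^{-1/3}`, THEN so do the increments of `momentumObservable (θ₀⁻¹ • u₀)` at parameter `c` (hypothesis H_M of
`WindowRenyiOfIncrementTightness`): the displacement part `Σᵢ ⟨J(xᵢ(s)) − J(xᵢ(0)), vᵢ(0)⟩`, `J = u₀/θ₀`, is LINEAR in the time-0 velocities and
exponentially negligible statically (no smallness condition on `c`). -/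
def MomentumIncrementOfFrozenTransfer : Prop :=
  ∀ (σ : ℝ) (a θ₀ : T3 → ℝ) (u₀ : T3 → V3), Continuous a → Continuous θ₀ → Continuous u₀ →
    (∀ x, 0 < a x) → (∀ x, 0 < θ₀ x) → ∀ (Φ : (N : ℕ) → TFlow σ N) (c : ℝ), 0 < c →
    (∀ τ ε : ℝ, 0 < τ → 0 < ε → ∃ N₀ : ℕ, ∀ N : ℕ, N₀ ≤ N → ∀ s : ℝ, 0 ≤ s →
        s ≤ τ * ((N : ℝ) + 1) ^ (-(1 / 3 : ℝ)) →
        ∫⁻ z, ENNReal.ofReal (Real.exp (2 * c *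
            |∑ i : Fin (N + 1), inner ℝ ((θ₀ ((Φ N).flow s z i).1)⁻¹ • u₀ ((Φ N).flow s z i).1)
              (((Φ N).flow s z i).2 - (z i).2)|))
          ∂(localGibbsLaw σ a u₀ θ₀ N (Φ N)) ≤ ENNReal.ofReal (Real.exp (ε * ((N : ℝ) + 1)))) →
    ∀ τ ε : ℝ, 0 < τ → 0 < ε → ∃ N₀ : ℕ, ∀ N : ℕ, N₀ ≤ N → ∀ s : ℝ, 0 ≤ s →
        s ≤ τ * ((N : ℝ) + 1) ^ (-(1 / 3 : ℝ)) →
        ∫⁻ z, ENNReal.ofReal (Real.exp (c *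
            |momentumObservable (fun x => (θ₀ x)⁻¹ • u₀ x) ((Φ N).flow s z) -
              momentumObservable (fun x => (θ₀ x)⁻¹ • u₀ x) z|))
          ∂(localGibbsLaw σ a u₀ θ₀ N (Φ N)) ≤ ENNReal.ofReal (Real.exp (ε * ((N : ℝ) + 1)))

/-! ## §2 Statics on the torus: bounded test fields with an affine modulus of continuity -/

/-- A continuous vector field on `𝕋³` has, for every `δ > 0`, an affine modulus against the minimal-image distance:
`‖J x − J y‖ ≤ δ + K · euclidDist x y` (uniform continuity on the compact torus, boundedness, and `‖x − y‖ ≤ euclidDist x y`;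
vector-valued twin of `KineticWindowGronwallDensityOnlyWindowRenyi.exists_affine_modulus`). [folklore] -/
theorem exists_affine_modulus_vec {J : T3 → V3} (hJ : Continuous J) {δ : ℝ} (hδ : 0 < δ) :
    ∃ K : ℝ, 0 ≤ K ∧ ∀ x y : T3, ‖J x - J y‖ ≤ δ + K * Torus.euclidDist x y := by
  obtain ⟨B, hB0, hB⟩ := exists_forall_abs_le_of_continuous hJ.norm
  have huc : UniformContinuous J := CompactSpace.uniformContinuous_of_continuous hJ
  obtain ⟨η, hη, hηJ⟩ := Metric.uniformContinuous_iff.1 huc δ hδ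
  refine ⟨2 * B / η, by positivity, fun x y => ?_⟩
  have hd0 : 0 ≤ Torus.euclidDist x y := by rw [Torus.euclidDist_eq]; exact norm_nonneg _
  by_cases hxy : Torus.euclidDist x y < η
  · have hd : dist x y < η := by
      rw [dist_eq_norm]
      exact (Torus.norm_sub_le_euclidDist_holds x y).trans_lt hxy
    have h := hηJ hd
    rw [dist_eq_norm] at h
    have : 0 ≤ 2 * B / η * Torus.euclidDist x y := mul_nonneg (by positivity) hd0
    linarith [h.le]
  · push Not at hxy
    have hx := hB x
    have hy := hB y
    rw [abs_of_nonneg (norm_nonneg _)] at hx hy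
    have h1 : ‖J x - J y‖ ≤ 2 * B := (norm_sub_le _ _).trans (by linarith)
    have h2 : 2 * B ≤ 2 * B / η * Torus.euclidDist x y := by
      rw [div_mul_eq_mul_div, le_div_iff₀ hη]
      exact mul_le_mul_of_nonneg_left hxy (by positivity)
    linarith

/-- **One particle.** If `‖J x' − J x‖ ≤ δ + K d` and `‖J x' − J x‖ ≤ 2 Jmax` (`d ≥ 0` the displacement), then for all
`η, R > 0`: `‖J x' − J x‖ ‖v‖ ≤ (δ + Kη)(1/2 + ‖v‖²/2) + Jmax R d/η + (Jmax/R)‖v‖²` — for `d < η` use `‖v‖ ≤ 1/2 + ‖v‖²/2`,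
for `d ≥ η` use `‖v‖ ≤ R/2 + ‖v‖²/(2R)` and `1 ≤ d/η`. [folklore] -/
theorem term_le {w v : V3} {d δ K η R Jmax : ℝ} (hd : 0 ≤ d) (hδ : 0 ≤ δ) (hK : 0 ≤ K) (hη : 0 < η) (hR : 0 < R)
    (hJmax : 0 ≤ Jmax) (hmod : ‖w‖ ≤ δ + K * d) (hbd : ‖w‖ ≤ 2 * Jmax) :
    ‖w‖ * ‖v‖ ≤ (δ + K * η) * (1 / 2 + ‖v‖ ^ 2 / 2) + Jmax * R / η * d + Jmax / R * ‖v‖ ^ 2 := by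
  have hv : 0 ≤ ‖v‖ := norm_nonneg v
  have hv1 : ‖v‖ ≤ 1 / 2 + ‖v‖ ^ 2 / 2 := by nlinarith [sq_nonneg (‖v‖ - 1)]
  have hA : 0 ≤ (δ + K * η) * (1 / 2 + ‖v‖ ^ 2 / 2) := by positivity
  have hB : 0 ≤ Jmax * R / η * d := by positivity
  have hC : 0 ≤ Jmax / R * ‖v‖ ^ 2 := by positivity
  rcases lt_or_ge d η with hlt | hge
  · have h1 : ‖w‖ ≤ δ + K * η := hmod.trans (by nlinarith)
    calc ‖w‖ * ‖v‖ ≤ (δ + K * η) * ‖v‖ := mul_le_mul_of_nonneg_right h1 hv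
      _ ≤ (δ + K * η) * (1 / 2 + ‖v‖ ^ 2 / 2) := mul_le_mul_of_nonneg_left hv1 (by positivity)
      _ ≤ _ := by linarith
  · have hvR : ‖v‖ ≤ R / 2 + ‖v‖ ^ 2 / (2 * R) := by
      have h : R / 2 + ‖v‖ ^ 2 / (2 * R) - ‖v‖ = (‖v‖ - R) ^ 2 / (2 * R) := by
        field_simp
        ring
      linarith [show 0 ≤ (‖v‖ - R) ^ 2 / (2 * R) by positivity]
    have hdη : 1 ≤ d / η := by rwa [le_div_iff₀ hη, one_mul]
    calc ‖w‖ * ‖v‖ ≤ 2 * Jmax * ‖v‖ := mul_le_mul_of_nonneg_right hbd hv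
      _ ≤ 2 * Jmax * (R / 2 + ‖v‖ ^ 2 / (2 * R)) := mul_le_mul_of_nonneg_left hvR (by positivity)
      _ = Jmax * R * 1 + Jmax / R * ‖v‖ ^ 2 := by
          field_simp
      _ ≤ Jmax * R * (d / η) + Jmax / R * ‖v‖ ^ 2 := by
          have : Jmax * R * 1 ≤ Jmax * R * (d / η) := mul_le_mul_of_nonneg_left hdη (by positivity)
          linarith
      _ = Jmax * R / η * d + Jmax / R * ‖v‖ ^ 2 := by ring
      _ ≤ _ := by linarith

/-- **The displacement part, summed.** For a bounded test field `‖J‖ ≤ Jmax` with affine modulus `(δ, K)`, two configurations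
`z, w` whose total displacement is `Σᵢ dist(xᵢ(w), xᵢ(z)) ≤ s((N+1)/2 + E(z))`, and `η, R > 0`:
`|Σᵢ ⟪J(xᵢ(w)) − J(xᵢ(z)), vᵢ(z)⟫| ≤ (δ + Kη + Jmax R s/η + 2Jmax/R)((N+1)/2 + E(z))` (sum `term_le`; `Σᵢ(1/2 + ‖vᵢ‖²/2) =
(N+1)/2 + E`, `Σᵢ‖vᵢ‖² = 2E ≤ 2((N+1)/2 + E)`). [folklore] -/
theorem abs_displacement_le {N : ℕ} {J : T3 → V3} {δ K η R Jmax s : ℝ} (hδ : 0 ≤ δ) (hK : 0 ≤ K) (hη : 0 < η)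
    (hR : 0 < R) (hJmax : ∀ x, ‖J x‖ ≤ Jmax) (hmod : ∀ x y, ‖J x - J y‖ ≤ δ + K * Torus.euclidDist x y)
    (z w : Config (N + 1) (Fin 3) T3)
    (hdisp : ∑ i, Torus.euclidDist (w i).1 (z i).1 ≤ s * (((N : ℝ) + 1) / 2 + configEnergy z)) :
    |∑ i, inner ℝ (J (w i).1 - J (z i).1) (z i).2| ≤
      (δ + K * η + Jmax * R / η * s + 2 * Jmax / R) * (((N : ℝ) + 1) / 2 + configEnergy z) := by
  have hJmax0 : 0 ≤ Jmax := (norm_nonneg _).trans (hJmax 0)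
  have hterm : ∀ i, |inner ℝ (J (w i).1 - J (z i).1) (z i).2| ≤
      (δ + K * η) * (1 / 2 + ‖(z i).2‖ ^ 2 / 2) + Jmax * R / η * Torus.euclidDist (w i).1 (z i).1 +
        Jmax / R * ‖(z i).2‖ ^ 2 := fun i =>
    (abs_real_inner_le_norm _ _).trans (term_le (by rw [Torus.euclidDist_eq]; exact norm_nonneg _) hδ hK hη hR hJmax0
      (hmod _ _) ((norm_sub_le _ _).trans (by linarith [hJmax (w i).1, hJmax (z i).1])))
  have hE : ∑ i, ‖(z i).2‖ ^ 2 = 2 * configEnergy z := by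
    simp only [configEnergy]
    ring
  have hsum1 : ∑ i : Fin (N + 1), (1 / 2 + ‖(z i).2‖ ^ 2 / 2) = ((N : ℝ) + 1) / 2 + configEnergy z := by
    rw [Finset.sum_add_distrib, Finset.sum_const, Finset.card_univ, Fintype.card_fin, nsmul_eq_mul, ← Finset.sum_div, hE]
    push_cast
    ring
  have hN1 : (0 : ℝ) ≤ (N : ℝ) + 1 := by positivity
  calc |∑ i, inner ℝ (J (w i).1 - J (z i).1) (z i).2|
      ≤ ∑ i, |inner ℝ (J (w i).1 - J (z i).1) (z i).2| := Finset.abs_sum_le_sum_abs _ _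
    _ ≤ ∑ i, ((δ + K * η) * (1 / 2 + ‖(z i).2‖ ^ 2 / 2) + Jmax * R / η * Torus.euclidDist (w i).1 (z i).1 +
          Jmax / R * ‖(z i).2‖ ^ 2) := Finset.sum_le_sum fun i _ => hterm i
    _ = (δ + K * η) * (((N : ℝ) + 1) / 2 + configEnergy z) + Jmax * R / η * ∑ i, Torus.euclidDist (w i).1 (z i).1 +
          Jmax / R * (2 * configEnergy z) := by
        rw [Finset.sum_add_distrib, Finset.sum_add_distrib, ← Finset.mul_sum, ← Finset.mul_sum, ← Finset.mul_sum, hsum1, hE]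
    _ ≤ (δ + K * η) * (((N : ℝ) + 1) / 2 + configEnergy z) + Jmax * R / η * (s * (((N : ℝ) + 1) / 2 + configEnergy z)) +
          Jmax / R * (2 * (((N : ℝ) + 1) / 2 + configEnergy z)) := by
        have h1 : Jmax * R / η * ∑ i, Torus.euclidDist (w i).1 (z i).1 ≤
            Jmax * R / η * (s * (((N : ℝ) + 1) / 2 + configEnergy z)) := mul_le_mul_of_nonneg_left hdisp (by positivity)
        have h2 : Jmax / R * (2 * configEnergy z) ≤ Jmax / R * (2 * (((N : ℝ) + 1) / 2 + configEnergy z)) :=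
          mul_le_mul_of_nonneg_left (by linarith) (by positivity)
        linarith
    _ = _ := by ring

/-! ## §3 Dynamics on good orbits: forward displacement against energy, and the pointwise increment bound -/

section Flow

variable {σ : ℝ} {N : ℕ} (Φ : TFlow σ N)

/-- **Total forward displacement against energy**: along a good orbit, for `s ≥ 0`,
`Σᵢ dist(xᵢ(s), xᵢ(0)) ≤ s((N+1)/2 + E(z))` (path length `HardSphereFlow.euclidDist_flow_le_integral_norm_vel`,
`‖v‖ ≤ ½ + ½‖v‖²` and energy conservation, `sum_integral_norm_vel_le`). [folklore] -/
theorem sum_euclidDist_flow_le {z : Config (N + 1) (Fin 3) T3} (hz : z ∈ Φ.good) {s : ℝ} (hs : 0 ≤ s) :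
    ∑ i, Torus.euclidDist ((Φ.flow s z i).1) ((z i).1) ≤ s * (((N : ℝ) + 1) / 2 + configEnergy z) := by
  have h1 : ∀ i, Torus.euclidDist ((Φ.flow s z i).1) ((z i).1) ≤ ∫ u in (0 : ℝ)..s, ‖(Φ.flow u z i).2‖ := by
    intro i
    simpa only [Φ.flow_zero z hz] using Φ.euclidDist_flow_le_integral_norm_vel hz i hs
  calc ∑ i, Torus.euclidDist ((Φ.flow s z i).1) ((z i).1)
      ≤ ∑ i, ∫ u in (0 : ℝ)..s, ‖(Φ.flow u z i).2‖ := Finset.sum_le_sum fun i _ => h1 i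
    _ ≤ (s - 0) * (((N + 1 : ℕ) : ℝ) / 2 + configEnergy z) := sum_integral_norm_vel_le Φ hz hs
    _ = s * (((N : ℝ) + 1) / 2 + configEnergy z) := by push_cast; ring

/-- **Frozen-coefficient decomposition of the momentum increment**: `M_J(w) − M_J(z) = T + D` with the transfer part
`T = Σᵢ ⟪J(xᵢ(w)), vᵢ(w) − vᵢ(z)⟫` (coefficients frozen at `w`) and the displacement part
`D = Σᵢ ⟪J(xᵢ(w)) − J(xᵢ(z)), vᵢ(z)⟫`. [folklore] -/
theorem momentumObservable_sub_eq (J : T3 → V3) (z w : Config (N + 1) (Fin 3) T3) :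
    momentumObservable J w - momentumObservable J z =
      ∑ i, inner ℝ (J (w i).1) ((w i).2 - (z i).2) + ∑ i, inner ℝ (J (w i).1 - J (z i).1) (z i).2 := by
  simp only [momentumObservable, ← Finset.sum_sub_distrib, ← Finset.sum_add_distrib, inner_sub_right, inner_sub_left]
  exact Finset.sum_congr rfl fun i _ => by ring

/-- **Pointwise increment bound on good orbits**: for good `z`, `s ≥ 0`, a bounded test field `‖J‖ ≤ Jmax` with affine
modulus `(δ, K)` and `η, R > 0`,
`|M_J(Φ_s z) − M_J(z)| ≤ |T(z)| + (δ + Kη + Jmax R s/η + 2Jmax/R)((N+1)/2 + E(z))`. [folklore] -/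
theorem abs_sub_le_of_good {z : Config (N + 1) (Fin 3) T3} (hz : z ∈ Φ.good) {s : ℝ} (hs : 0 ≤ s) {J : T3 → V3}
    {δ K η R Jmax : ℝ} (hδ : 0 ≤ δ) (hK : 0 ≤ K) (hη : 0 < η) (hR : 0 < R) (hJmax : ∀ x, ‖J x‖ ≤ Jmax)
    (hmod : ∀ x y, ‖J x - J y‖ ≤ δ + K * Torus.euclidDist x y) :
    |momentumObservable J (Φ.flow s z) - momentumObservable J z| ≤
      |∑ i, inner ℝ (J (Φ.flow s z i).1) ((Φ.flow s z i).2 - (z i).2)| +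
        (δ + K * η + Jmax * R / η * s + 2 * Jmax / R) * (((N : ℝ) + 1) / 2 + configEnergy z) := by
  rw [momentumObservable_sub_eq]
  refine (abs_add_le _ _).trans (add_le_add le_rfl ?_)
  exact abs_displacement_le hδ hK hη hR hJmax hmod z (Φ.flow s z) (sum_euclidDist_flow_le Φ hz hs)

end Flow

/-! ## §4 The integrated estimate: Hölder, the transfer hypothesis and the Gaussian energy moment -/

section Integrated

variable {σ : ℝ} {a θ₀ : T3 → ℝ} {u₀ : T3 → V3}

/-- **The integrated estimate** (general continuous data `a, θ₀ > 0` with `θ₀ ≤ θM`, `‖u₀‖ ≤ U`; any reduced density; a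
continuous test field `J`; `c ≥ 0`, `A ≥ 0` with `2cA ≤ 1/(4θM)`): IF `λ_N`-a.e. `|M_J(Φ_s z) − M_J(z)| ≤ |T(z)| + A((N+1)/2 + E(z))`
and `∫ exp(2c|T|) dλ_N ≤ e^{ε(N+1)}`, THEN `∫ exp(c|M_J(Φ_s z) − M_J(z)|) λ_N(dz) ≤ exp(((1 + C₀)cA + ε)(N+1)/2)`,
`C₀ = 1 + 2U² + 12θM` — `exp(c|T| + cA(N+1)/2 + cAE)`, Hölder(2,2), and `∫ exp(2cA·E) dλ_N ≤ exp(C₀ cA (N+1))`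
(`KineticWindowGronwallWindowRenyiOfIncrementTightnessPrelim.lintegral_exp_mul_configEnergy_le`). [folklore] -/
theorem lintegral_exp_abs_sub_le (ha : Continuous a) (hθ : Continuous θ₀) (hu : Continuous u₀) (ha0 : ∀ x, 0 < a x)
    (hθ0 : ∀ x, 0 < θ₀ x) {θM U : ℝ} (hθM : ∀ x, θ₀ x ≤ θM) (hU : ∀ x, ‖u₀ x‖ ≤ U) (N : ℕ) (Φ : TFlow σ N) (s : ℝ)
    {J : T3 → V3} (hJ : Continuous J) {c A ε : ℝ} (hc : 0 ≤ c) (hA : 0 ≤ A) (hcA : 2 * c * A ≤ 1 / (4 * θM))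
    (hpt : ∀ᵐ z ∂(localGibbsLaw σ a u₀ θ₀ N Φ), |momentumObservable J (Φ.flow s z) - momentumObservable J z| ≤
      |∑ i, inner ℝ (J (Φ.flow s z i).1) ((Φ.flow s z i).2 - (z i).2)| + A * (((N : ℝ) + 1) / 2 + configEnergy z))
    (hT : ∫⁻ z, ENNReal.ofReal (Real.exp (2 * c * |∑ i, inner ℝ (J (Φ.flow s z i).1) ((Φ.flow s z i).2 - (z i).2)|))
      ∂(localGibbsLaw σ a u₀ θ₀ N Φ) ≤ ENNReal.ofReal (Real.exp (ε * ((N : ℝ) + 1)))) :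
    ∫⁻ z, ENNReal.ofReal (Real.exp (c * |momentumObservable J (Φ.flow s z) - momentumObservable J z|))
        ∂(localGibbsLaw σ a u₀ θ₀ N Φ) ≤
      ENNReal.ofReal (Real.exp (((1 + (1 + 2 * U ^ 2 + 12 * θM)) * (c * A) + ε) / 2 * ((N : ℝ) + 1))) := by
  set P := localGibbsLaw σ a u₀ θ₀ N Φ with hP
  set T : Config (N + 1) (Fin 3) T3 → ℝ := fun z => ∑ i, inner ℝ (J (Φ.flow s z i).1) ((Φ.flow s z i).2 - (z i).2)
    with hTdef
  set f : Config (N + 1) (Fin 3) T3 → ℝ≥0∞ := fun z => ENNReal.ofReal (Real.exp (c * |T z|)) with hfdef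
  set g : Config (N + 1) (Fin 3) T3 → ℝ≥0∞ := fun z => ENNReal.ofReal (Real.exp (c * A * configEnergy z)) with hgdef
  set K₁ : ℝ≥0∞ := ENNReal.ofReal (Real.exp (c * A / 2 * ((N : ℝ) + 1))) with hK₁
  -- `(e^x)^2 = e^{2x}` and `(e^x)^{1/2} = e^{x/2}` in `ℝ≥0∞`
  have hsq : ∀ x : ℝ, ENNReal.ofReal (Real.exp x) ^ (2 : ℝ) = ENNReal.ofReal (Real.exp (2 * x)) := fun x => by
    rw [ENNReal.ofReal_rpow_of_nonneg (Real.exp_pos _).le (by norm_num), ← Real.exp_mul, mul_comm]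
  have hhalf : ∀ x : ℝ, ENNReal.ofReal (Real.exp x) ^ (1 / (2 : ℝ)) = ENNReal.ofReal (Real.exp (x / 2)) := fun x => by
    rw [ENNReal.ofReal_rpow_of_nonneg (Real.exp_pos _).le (by norm_num), ← Real.exp_mul, mul_one_div]
  -- measurability
  have hflow : ∀ i : Fin (N + 1), Measurable fun z : Config (N + 1) (Fin 3) T3 => Φ.flow s z i := fun i =>
    (measurable_pi_apply i).comp (Φ.measurable_flow s)
  have hTm : Measurable T := by
    refine Finset.measurable_sum _ fun i _ => ?_
    exact (hJ.measurable.comp (hflow i).fst).inner ((hflow i).snd.sub (measurable_pi_apply i).snd)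
  have hfm : Measurable f := (measurable_const.mul (continuous_abs.measurable.comp hTm)).exp.ennreal_ofReal
  have hEm : Measurable (configEnergy : Config (N + 1) (Fin 3) T3 → ℝ) :=
    measurable_const.mul (Finset.measurable_sum _ fun i _ => (measurable_pi_apply i).snd.norm.pow_const 2)
  have hgm : Measurable g := (measurable_const.mul hEm).exp.ennreal_ofReal
  -- pointwise: `exp(c|ΔM|) ≤ K₁ · f · g`
  have hpt' : ∀ᵐ z ∂P, ENNReal.ofReal (Real.exp (c * |momentumObservable J (Φ.flow s z) - momentumObservable J z|)) ≤
      K₁ * (f * g) z := by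
    filter_upwards [hpt] with z hz
    simp only [hK₁, hfdef, hgdef, Pi.mul_apply]
    rw [← ENNReal.ofReal_mul (Real.exp_pos _).le, ← Real.exp_add, ← ENNReal.ofReal_mul (Real.exp_pos _).le,
      ← Real.exp_add]
    refine ENNReal.ofReal_le_ofReal (Real.exp_le_exp.2 ?_)
    calc c * |momentumObservable J (Φ.flow s z) - momentumObservable J z|
        ≤ c * (|T z| + A * (((N : ℝ) + 1) / 2 + configEnergy z)) := mul_le_mul_of_nonneg_left hz hc
      _ = c * A / 2 * ((N : ℝ) + 1) + (c * |T z| + c * A * configEnergy z) := by ring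
  -- the two quadratic moments
  have hf2 : ∫⁻ z, f z ^ (2 : ℝ) ∂P = ∫⁻ z, ENNReal.ofReal (Real.exp (2 * c * |T z|)) ∂P :=
    lintegral_congr fun z => by simp only [hfdef]; rw [hsq, mul_assoc]
  have hg2 : ∫⁻ z, g z ^ (2 : ℝ) ∂P ≤
      ENNReal.ofReal (Real.exp ((1 + 2 * U ^ 2 + 12 * θM) * (2 * c * A / 2) * ((N : ℝ) + 1))) := by
    calc ∫⁻ z, g z ^ (2 : ℝ) ∂P = ∫⁻ z, ENNReal.ofReal (Real.exp (2 * c * A * configEnergy z)) ∂P :=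
          lintegral_congr fun z => by simp only [hgdef]; rw [hsq]; ring_nf
      _ ≤ _ := KineticWindowGronwallWindowRenyiOfIncrementTightnessPrelim.lintegral_exp_mul_configEnergy_le ha hθ hu ha0
          hθ0 hθM hU σ N Φ (by positivity) hcA
  calc ∫⁻ z, ENNReal.ofReal (Real.exp (c * |momentumObservable J (Φ.flow s z) - momentumObservable J z|)) ∂P
      ≤ ∫⁻ z, K₁ * (f * g) z ∂P := lintegral_mono_ae hpt'
    _ = K₁ * ∫⁻ z, (f * g) z ∂P := lintegral_const_mul' _ _ ENNReal.ofReal_ne_top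
    _ ≤ K₁ * ((∫⁻ z, f z ^ (2 : ℝ) ∂P) ^ (1 / (2 : ℝ)) * (∫⁻ z, g z ^ (2 : ℝ) ∂P) ^ (1 / (2 : ℝ))) :=
        mul_le_mul' le_rfl (ENNReal.lintegral_mul_le_Lp_mul_Lq P Real.HolderConjugate.two_two hfm.aemeasurable
          hgm.aemeasurable)
    _ ≤ K₁ * ((ENNReal.ofReal (Real.exp (ε * ((N : ℝ) + 1)))) ^ (1 / (2 : ℝ)) *
          (ENNReal.ofReal (Real.exp ((1 + 2 * U ^ 2 + 12 * θM) * (2 * c * A / 2) * ((N : ℝ) + 1)))) ^ (1 / (2 : ℝ))) := by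
        refine mul_le_mul' le_rfl (mul_le_mul' (ENNReal.rpow_le_rpow ?_ (by norm_num)) (ENNReal.rpow_le_rpow hg2 (by norm_num)))
        rw [hf2]
        exact hT
    _ = ENNReal.ofReal (Real.exp (((1 + (1 + 2 * U ^ 2 + 12 * θM)) * (c * A) + ε) / 2 * ((N : ℝ) + 1))) := by
        rw [hhalf, hhalf, ← ENNReal.ofReal_mul (Real.exp_pos _).le, ← Real.exp_add, hK₁,
          ← ENNReal.ofReal_mul (Real.exp_pos _).le, ← Real.exp_add]
        congr 2
        ring

end Integrated

/-! ## §5 Assembly: the registered stub -/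

/-- **`stub_momentumIncrementOfFrozenTransfer`: the registered statement `MomentumIncrementOfFrozenTransfer` holds.** Order of
choices, given `c, ε`: the target size `A₀ = min(ε/((1+C₀)c), 1/(8cθM))` of the displacement coefficient; `R` with
`2Jmax/R ≤ A₀/3`; `δ = A₀/6` and its modulus constant `K`; `η` with `Kη ≤ A₀/6`; `s₀` with `Jmax R s₀/η ≤ A₀/3`; finally `N₀`
from the hypothesis at `(τ, ε)` and from `τ(N+1)^{-1/3} ≤ s₀` eventually. [folklore] -/
theorem stub_momentumIncrementOfFrozenTransfer : MomentumIncrementOfFrozenTransfer := by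
  intro σ a θ₀ u₀ ha hθ hu ha0 hθ0 Φ c hc hyp τ ε hτ hε
  -- bounds on the data and on the test field `J = θ₀⁻¹ • u₀`
  obtain ⟨-, θM, -, -, hθM⟩ := KineticWindowGronwallPlusNode.exists_bounds_T3 hθ
  have hθMpos : 0 < θM := (hθ0 0).trans_le (hθM 0)
  obtain ⟨-, U, -, -, hU⟩ := KineticWindowGronwallPlusNode.exists_bounds_T3 hu.norm
  have hJ : Continuous fun x => (θ₀ x)⁻¹ • u₀ x := (hθ.inv₀ fun x => (hθ0 x).ne').smul hu
  obtain ⟨-, Jmax, -, -, hJmax⟩ := KineticWindowGronwallPlusNode.exists_bounds_T3 hJ.norm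
  have hJmax0 : 0 ≤ Jmax := (norm_nonneg _).trans (hJmax 0)
  set C₀ : ℝ := 1 + 2 * U ^ 2 + 12 * θM with hC₀
  have hC₀pos : 0 < C₀ := by positivity
  -- the target size of the displacement coefficient
  set A₀ : ℝ := min (ε / ((1 + C₀) * c)) (1 / (8 * c * θM)) with hA₀
  have hA₀pos : 0 < A₀ := lt_min (by positivity) (by positivity)
  -- the parameters `R`, `δ`, `K`, `η`, `s₀`
  obtain ⟨R, hR, hRle⟩ : ∃ R : ℝ, 0 < R ∧ 2 * Jmax / R ≤ A₀ / 3 := by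
    refine ⟨(6 * Jmax + 6) / A₀, by positivity, ?_⟩
    rw [div_le_iff₀ (by positivity)]
    have h : A₀ / 3 * ((6 * Jmax + 6) / A₀) = 2 * Jmax + 2 := by field_simp; ring
    linarith
  obtain ⟨K, hK0, hK⟩ := exists_affine_modulus_vec hJ (δ := A₀ / 6) (by positivity)
  obtain ⟨η, hη, hKη⟩ : ∃ η : ℝ, 0 < η ∧ K * η ≤ A₀ / 6 := by
    refine ⟨A₀ / (6 * (K + 1)), by positivity, ?_⟩
    calc K * (A₀ / (6 * (K + 1))) ≤ (K + 1) * (A₀ / (6 * (K + 1))) :=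
          mul_le_mul_of_nonneg_right (by linarith) (by positivity)
      _ = A₀ / 6 := by field_simp
  obtain ⟨s₀, hs₀, hs₀le⟩ : ∃ s₀ : ℝ, 0 < s₀ ∧ Jmax * R / η * s₀ ≤ A₀ / 3 := by
    refine ⟨η * (A₀ / (3 * (Jmax * R + 1))), by positivity, ?_⟩
    calc Jmax * R / η * (η * (A₀ / (3 * (Jmax * R + 1)))) = Jmax * R * (A₀ / (3 * (Jmax * R + 1))) := by
          field_simp
      _ ≤ (Jmax * R + 1) * (A₀ / (3 * (Jmax * R + 1))) := mul_le_mul_of_nonneg_right (by linarith) (by positivity)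
      _ = A₀ / 3 := by field_simp
  -- `N₀`: the hypothesis at `(τ, ε)` and the window length below `s₀`
  obtain ⟨N₁, hN₁⟩ := hyp τ ε hτ hε
  have hwin : Tendsto (fun N : ℕ => τ * ((N : ℝ) + 1) ^ (-(1 / 3 : ℝ))) atTop (nhds 0) := by
    simpa using ((tendsto_rpow_neg_atTop (by norm_num : (0 : ℝ) < 1 / 3)).comp
      (tendsto_atTop_add_const_right _ 1 tendsto_natCast_atTop_atTop)).const_mul τ
  obtain ⟨N₂, hN₂⟩ := eventually_atTop.1 (hwin.eventually (Iic_mem_nhds hs₀))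
  refine ⟨max N₁ N₂, fun N hN s hs0 hs => ?_⟩
  have hsN : s ≤ s₀ := hs.trans (hN₂ N ((le_max_right _ _).trans hN))
  -- the displacement coefficient `A ≤ A₀`
  set A : ℝ := A₀ / 6 + K * η + Jmax * R / η * s + 2 * Jmax / R with hAdef
  have hApos : 0 ≤ A := by positivity
  have hAle : A ≤ A₀ := by
    have h3 : Jmax * R / η * s ≤ A₀ / 3 := (mul_le_mul_of_nonneg_left hsN (by positivity)).trans hs₀le
    rw [hAdef]
    linarith
  have h2cA : 2 * c * A ≤ 1 / (4 * θM) :=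
    calc 2 * c * A ≤ 2 * c * A₀ := mul_le_mul_of_nonneg_left hAle (by positivity)
      _ ≤ 2 * c * (1 / (8 * c * θM)) := mul_le_mul_of_nonneg_left (min_le_right _ _) (by positivity)
      _ = 1 / (4 * θM) := by field_simp; ring
  have hεA : (1 + C₀) * (c * A) ≤ ε :=
    calc (1 + C₀) * (c * A) ≤ (1 + C₀) * (c * A₀) :=
          mul_le_mul_of_nonneg_left (mul_le_mul_of_nonneg_left hAle hc.le) (by positivity)
      _ ≤ (1 + C₀) * (c * (ε / ((1 + C₀) * c))) :=
          mul_le_mul_of_nonneg_left (mul_le_mul_of_nonneg_left (min_le_left _ _) hc.le) (by positivity)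
      _ = ε := by field_simp
  -- pointwise bound on good orbits, then the integrated estimate
  have hpt : ∀ᵐ z ∂(localGibbsLaw σ a u₀ θ₀ N (Φ N)),
      |momentumObservable (fun x => (θ₀ x)⁻¹ • u₀ x) ((Φ N).flow s z) -
          momentumObservable (fun x => (θ₀ x)⁻¹ • u₀ x) z| ≤
        |∑ i, inner ℝ ((fun x => (θ₀ x)⁻¹ • u₀ x) ((Φ N).flow s z i).1) (((Φ N).flow s z i).2 - (z i).2)| +
          A * (((N : ℝ) + 1) / 2 + configEnergy z) := by
    filter_upwards [KineticWindowGronwallQuadraticMoment.ae_mem_good_localGibbsLaw σ a u₀ θ₀ N (Φ N)] with z hz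
    exact abs_sub_le_of_good (Φ N) hz hs0 (by positivity) hK0 hη hR hJmax hK
  have hT := hN₁ N ((le_max_left _ _).trans hN) s hs0 hs
  calc ∫⁻ z, ENNReal.ofReal (Real.exp (c *
          |momentumObservable (fun x => (θ₀ x)⁻¹ • u₀ x) ((Φ N).flow s z) -
            momentumObservable (fun x => (θ₀ x)⁻¹ • u₀ x) z|)) ∂(localGibbsLaw σ a u₀ θ₀ N (Φ N))
      ≤ ENNReal.ofReal (Real.exp (((1 + (1 + 2 * U ^ 2 + 12 * θM)) * (c * A) + ε) / 2 * ((N : ℝ) + 1))) :=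
        lintegral_exp_abs_sub_le ha hθ hu ha0 hθ0 hθM hU N (Φ N) s hJ hc.le hApos h2cA hpt hT
    _ ≤ ENNReal.ofReal (Real.exp (ε * ((N : ℝ) + 1))) := by
        refine ENNReal.ofReal_le_ofReal (Real.exp_le_exp.2 ?_)
        have hN1 : (0 : ℝ) ≤ (N : ℝ) + 1 := by positivity
        have key : ((1 + C₀) * (c * A) + ε) / 2 ≤ ε := by linarith
        exact mul_le_mul_of_nonneg_right key hN1

end Summit.AtomisticToContinuum.HydrodynamicLimit.Theorems.KineticWindowGronwallMomentumIncrementOfFrozenTransfer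

end
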